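import Summits.QuantumFields.YangMills.Theorems.ColdStartUniversalityLatticeLangevinSubsolution
import Summits.QuantumFields.YangMills.Theorems.ColdStartUniversalityLatticeLangevinHeatKernelDomination
import Summits.QuantumFields.YangMills.Theorems.ColdStartUniversalityLatticeLangevinTransitionRidge
import Summits.QuantumFields.YangMills.Theorems.ColdStartUniversalityUniformColdStartMixingDictionary
import HarnessLib

/-!
# Route `ColdStartUniversality`, crux `NeutralColdStartMixing` (stmt-QuantumFields-27363): the registered stub
# `stub_langevinLawAbsCont` — the law of the SU(2) SZZ dynamics at every positive time is absolutely continuous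

Seat `ym-line-csu-p1`, g8.  For every coupling `β'`, every solution `U` of the SU(2) lattice Langevin dynamics from a deterministic
start on any probability space and every `t > 0`: `law(U_t) ≪ Haar^{⊗E}` (`map_absolutelyContinuous_haar`).  Chain:
* `integral_le_exp_mul_integral_beta_zero` — `E f(X^z_t) ≤ e^{Kt+M} E f(Y^z_t)` for continuous `0 ≤ f ≤ 1` (`X` at `β'`, `Y` at `0`,
  regular flows): the ground-state SUBsolution inequality `groundState_subsolution` extended from ridge form by uniform density
  (`exists_ridge_uniform_near`) — the mirror image of `integral_le_of_groundState`;
* hence `law(X^z_t) ≤ e^{Kt+M} · law(Y^z_t)` (`measure_le_of_forall_integral_le`) and `law(Y^z_t) ≤ C · Haar^{⊗E}`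
  (`map_le_smul_haar_beta_zero`), uniqueness in law (`lawUnique_of_start`) transporting to any space;
* `stub_langevinLawAbsCont` — by name and signature: the cold-start law read through the bond dictionary is absolutely continuous
  with respect to Bałaban's `fieldMeasure` (`measurePreserving_pullback`).
HONEST FRAMING: a support stub (C2 of the valley line); the load-bearing stubs of crux 27363 are untouched; RECORD-rung R3 plumbing;
the Yang–Mills mass gap is NOT proved.  No definition, no sorry.
-/

set_option autoImplicit false

noncomputable section

namespace Summit.QuantumFields.YangMills.Theorems.ColdStartUniversality

open MeasureTheory ProbabilityTheory Finset Metric Filter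
open scoped BigOperators Topology NNReal ENNReal
open Literature.Probability.Process Literature.MathematicalPhysics.QuantumFieldTheory Literature.Analysis.SpecialFunctions
open Literature.MathematicalPhysics.QuantumLattice (fundamentalRep fundamentalLatticeRep continuous_fundamentalRep
  fundamentalRep_injective fundamentalRep_mem_unitaryGroup)

variable {L : ℕ} [NeZero L]

/-- **Upper comparison with the `β' = 0` dynamics**: for continuous `0 ≤ f ≤ 1`, `E f(X^z_t) ≤ e^{Kt+M} E f(Y^z_t)` (`X` the SZZ
flow at `β'`, `Y` at `β' = 0`, both with the regular-flow clause). [folklore] -/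
theorem integral_le_exp_mul_integral_beta_zero (β' : ℝ)
    {Ω : Type} [MeasurableSpace Ω] {P : Measure Ω} [IsProbabilityMeasure P]
    {W : ℝ≥0 → Ω → (Edge 3 L × NoiseIdx 2 → ℝ)} (hW : IsFlatBrownian W P)
    (U : GaugeConfig 3 L (Matrix.specialUnitaryGroup (Fin 2) ℂ) → ℝ≥0 → Ω →
      GaugeConfig 3 L (Matrix.specialUnitaryGroup (Fin 2) ℂ))
    (hU : ∀ x, (∀ ω, U x 0 ω = x) ∧
      (latticeLangevinDynamics (fundamentalLatticeRep 2) β').IsSolution (fundamentalRep (Fin 2))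
        hW.natFiltration P W (U x))
    (hUm : ∀ i : ℝ≥0, Measurable[@Prod.instMeasurableSpace (Set.Iic i)
        (GaugeConfig 3 L (Matrix.specialUnitaryGroup (Fin 2) ℂ) × Ω) inferInstance
        (@Prod.instMeasurableSpace (GaugeConfig 3 L (Matrix.specialUnitaryGroup (Fin 2) ℂ)) Ω inferInstance
          (hW.natFiltration i))]
      (fun q : Set.Iic i × (GaugeConfig 3 L (Matrix.specialUnitaryGroup (Fin 2) ℂ) × Ω) => U q.2.1 q.1 q.2.2))
    {Ω' : Type} [MeasurableSpace Ω'] {P' : Measure Ω'} [IsProbabilityMeasure P']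
    {W' : ℝ≥0 → Ω' → (Edge 3 L × NoiseIdx 2 → ℝ)} (hW' : IsFlatBrownian W' P')
    (Y : GaugeConfig 3 L (Matrix.specialUnitaryGroup (Fin 2) ℂ) → ℝ≥0 → Ω' →
      GaugeConfig 3 L (Matrix.specialUnitaryGroup (Fin 2) ℂ))
    (hY : ∀ x, (∀ ω, Y x 0 ω = x) ∧
      (latticeLangevinDynamics (fundamentalLatticeRep 2) 0).IsSolution (fundamentalRep (Fin 2))
        hW'.natFiltration P' W' (Y x))
    (hYm : ∀ i : ℝ≥0, Measurable[@Prod.instMeasurableSpace (Set.Iic i)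
        (GaugeConfig 3 L (Matrix.specialUnitaryGroup (Fin 2) ℂ) × Ω') inferInstance
        (@Prod.instMeasurableSpace (GaugeConfig 3 L (Matrix.specialUnitaryGroup (Fin 2) ℂ)) Ω' inferInstance
          (hW'.natFiltration i))]
      (fun q : Set.Iic i × (GaugeConfig 3 L (Matrix.specialUnitaryGroup (Fin 2) ℂ) × Ω') => Y q.2.1 q.1 q.2.2)) :
    ∃ K Mψ : ℝ, ∀ (f : GaugeConfig 3 L (Matrix.specialUnitaryGroup (Fin 2) ℂ) → ℝ), Continuous f → (∀ V, 0 ≤ f V) →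
      (∀ V, f V ≤ 1) → ∀ (z : GaugeConfig 3 L (Matrix.specialUnitaryGroup (Fin 2) ℂ)) (t : ℝ≥0),
        ∫ ω, f (U z t ω) ∂P ≤ Real.exp (K * t + Mψ) * ∫ ω', f (Y z t ω') ∂P' := by
  classical
  haveI := secondCountableTopology_su2
  haveI := borelSpace_config L
  obtain ⟨K₀, Mψ, hψc, hKM⟩ := exists_groundState_bounds (L := L) β'
  obtain ⟨K, hK0, hK⟩ := exists_abs_groundStatePotential_le (L := L) β'
  -- the plaquette function on the group and the ground state
  set ψV : GaugeConfig 3 L (Matrix.specialUnitaryGroup (Fin 2) ℂ) → ℝ := fun V =>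
      β' * ∑ p : Plaquette 3 L, (rootedLoop (fun (e : Edge 3 L) (i j : Fin 2) =>
        ((((fundamentalRep (Fin 2) (V e) : Matrix (Fin 2) (Fin 2) ℂ) i j).re : ℝ) : ℂ) +
          ((((fundamentalRep (Fin 2) (V e) : Matrix (Fin 2) (Fin 2) ℂ) i j).im : ℝ) : ℂ) * Complex.I)
        (p.1, p.2.1.1) p.2.1.2 false).trace.re with hψVdef
  set φ : GaugeConfig 3 L (Matrix.specialUnitaryGroup (Fin 2) ℂ) → ℝ := fun V => Real.exp (-(1 / 2 : ℝ) * ψV V) with hφdef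
  have hφc : Continuous φ := Real.continuous_exp.comp (continuous_const.mul hψc)
  have hφpos : ∀ V, 0 < φ V := fun V => Real.exp_pos _
  have hψVabs : ∀ V, |ψV V| ≤ Mψ := fun V => (hKM V).2
  have hφup : ∀ V, φ V ≤ Real.exp (Mψ / 2) := fun V => by
    rw [hφdef]; apply Real.exp_le_exp.2
    have := (abs_le.1 (hψVabs V)).1; linarith
  have hφlow : ∀ V, Real.exp (-(Mψ / 2)) ≤ φ V := fun V => by
    rw [hφdef]; apply Real.exp_le_exp.2
    have := (abs_le.1 (hψVabs V)).2; linarith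
  refine ⟨K, Mψ, fun f hf hf0 hf1 z t => ?_⟩
  -- measurability / integrability boilerplate
  have hmU : Measurable (U z t) := ((hU z).2.adapted t).mono (hW.natFiltration.le t) le_rfl
  have hmY : Measurable (Y z t) := ((hY z).2.adapted t).mono (hW'.natFiltration.le t) le_rfl
  have hint : ∀ {g : GaugeConfig 3 L (Matrix.specialUnitaryGroup (Fin 2) ℂ) → ℝ}, Continuous g →
      Integrable (fun ω => g (U z t ω)) P ∧ Integrable (fun ω' => g (Y z t ω')) P' := by
    intro g hg
    obtain ⟨M, -, hM⟩ := exists_abs_le_of_continuous hg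
    exact ⟨Integrable.of_bound (hg.measurable.comp hmU).aestronglyMeasurable M
        (Eventually.of_forall fun ω => by rw [Real.norm_eq_abs]; exact hM _),
      Integrable.of_bound (hg.measurable.comp hmY).aestronglyMeasurable M
        (Eventually.of_forall fun ω => by rw [Real.norm_eq_abs]; exact hM _)⟩
  -- `G = f / φ`
  set G : GaugeConfig 3 L (Matrix.specialUnitaryGroup (Fin 2) ℂ) → ℝ := fun V => f V / φ V with hGdef
  have hGc : Continuous G := hf.div hφc fun V => (hφpos V).ne'
  have hG0 : ∀ V, 0 ≤ G V := fun V => div_nonneg (hf0 V) (hφpos V).le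
  have hφG : ∀ V, φ V * G V = f V := fun V => by rw [hGdef]; field_simp [(hφpos V).ne']
  have hGup : ∀ V, G V ≤ Real.exp (Mψ / 2) * f V := by
    intro V
    rw [hGdef, div_le_iff₀ (hφpos V)]
    calc f V = (Real.exp (Mψ / 2) * Real.exp (-(Mψ / 2))) * f V := by rw [← Real.exp_add]; simp
      _ ≤ (Real.exp (Mψ / 2) * φ V) * f V :=
          mul_le_mul_of_nonneg_right (mul_le_mul_of_nonneg_left (hφlow V) (Real.exp_pos _).le) (hf0 V)
      _ = Real.exp (Mψ / 2) * f V * φ V := by ring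
  -- approximation by latitude eigenfunctions, keeping nonnegativity
  have hmain : ∀ ε : ℝ, 0 < ε →
      Real.exp (-(K * t)) * ∫ ω, f (U z t ω) ∂P ≤ Real.exp (Mψ / 2) * (Real.exp (Mψ / 2) * ∫ ω', f (Y z t ω') ∂P' + 2 * ε) := by
    intro ε hε
    obtain ⟨κ, hκ, c, g, m, hF⟩ := exists_ridge_uniform_near (L := L) hGc hε
    obtain ⟨κ', hκ', c', g', m', hF'⟩ := exists_ridge_add ⟨κ, hκ, c, g, m, fun V => rfl⟩ (exists_ridge_const (L := L) ε)
    have hF'0 : ∀ V : GaugeConfig 3 L (Matrix.specialUnitaryGroup (Fin 2) ℂ), 0 ≤ ∑ l, c' l * ∏ e, gegenbauerSum 1 (m' l e)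
        (hsForm 2 (fundamentalRep (Fin 2) (g' l e)) (fundamentalRep (Fin 2) (V e)) / 2) := by
      intro V; rw [← hF' V]
      have := (abs_lt.1 (hF V)).1
      linarith [hG0 V]
    have hF'G : ∀ V : GaugeConfig 3 L (Matrix.specialUnitaryGroup (Fin 2) ℂ),
        G V ≤ ∑ l, c' l * ∏ e, gegenbauerSum 1 (m' l e)
          (hsForm 2 (fundamentalRep (Fin 2) (g' l e)) (fundamentalRep (Fin 2) (V e)) / 2) ∧
        ∑ l, c' l * ∏ e, gegenbauerSum 1 (m' l e)
          (hsForm 2 (fundamentalRep (Fin 2) (g' l e)) (fundamentalRep (Fin 2) (V e)) / 2) ≤ G V + 2 * ε := by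
      intro V; rw [← hF' V]
      have h := abs_lt.1 (hF V)
      constructor <;> linarith [h.1, h.2]
    have hsub := groundState_subsolution (L := L) β' hW U hU hUm hW' Y hY hYm c' g' m' hF'0 K
      (fun V => by
        have h := (abs_le.1 (hK V)).1
        exact h) z t
    dsimp only at hsub
    have hRc : Continuous fun V : GaugeConfig 3 L (Matrix.specialUnitaryGroup (Fin 2) ℂ) =>
        ∑ l, c' l * ∏ e, gegenbauerSum 1 (m' l e)
          (hsForm 2 (fundamentalRep (Fin 2) (g' l e)) (fundamentalRep (Fin 2) (V e)) / 2) :=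
      continuous_finsetSum _ fun l _ => continuous_const.mul (continuous_prod_gegenbauer_latitude (L := L) (g' l) (m' l))
    -- `E f(X) = E[φ G(X)] ≤ E[φ F'(X)]`
    have hleft : ∫ ω, f (U z t ω) ∂P ≤ ∫ ω, φ (U z t ω) * (∑ l, c' l * ∏ e, gegenbauerSum 1 (m' l e)
        (hsForm 2 (fundamentalRep (Fin 2) (g' l e)) (fundamentalRep (Fin 2) (U z t ω e)) / 2)) ∂P := by
      refine integral_mono (hint hf).1 (hint (hφc.mul hRc)).1 fun ω => ?_
      dsimp only
      rw [← hφG]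
      exact mul_le_mul_of_nonneg_left (hF'G _).1 (hφpos _).le
    -- `φ(z) E F'(Y) ≤ Φmax (E G(Y) + 2ε) ≤ Φmax (Φmax E f(Y) + 2ε)`
    have hright : φ z * ∫ ω', (∑ l, c' l * ∏ e, gegenbauerSum 1 (m' l e)
        (hsForm 2 (fundamentalRep (Fin 2) (g' l e)) (fundamentalRep (Fin 2) (Y z t ω' e)) / 2)) ∂P' ≤
        Real.exp (Mψ / 2) * (Real.exp (Mψ / 2) * ∫ ω', f (Y z t ω') ∂P' + 2 * ε) := by
      have h1 : ∫ ω', (∑ l, c' l * ∏ e, gegenbauerSum 1 (m' l e)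
          (hsForm 2 (fundamentalRep (Fin 2) (g' l e)) (fundamentalRep (Fin 2) (Y z t ω' e)) / 2)) ∂P' ≤
          ∫ ω', (Real.exp (Mψ / 2) * f (Y z t ω') + 2 * ε) ∂P' := by
        refine integral_mono (hint hRc).2 (((hint hf).2.const_mul _).add (integrable_const _)) fun ω' => ?_
        exact (hF'G _).2.trans (by linarith [hGup (Y z t ω')])
      rw [integral_add ((hint hf).2.const_mul _) (integrable_const _), integral_const, smul_eq_mul, probReal_univ, one_mul,
        MeasureTheory.integral_const_mul] at h1
      have h0 : 0 ≤ ∫ ω', (∑ l, c' l * ∏ e, gegenbauerSum 1 (m' l e)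
          (hsForm 2 (fundamentalRep (Fin 2) (g' l e)) (fundamentalRep (Fin 2) (Y z t ω' e)) / 2)) ∂P' :=
        integral_nonneg fun ω' => hF'0 _
      calc φ z * _ ≤ Real.exp (Mψ / 2) * ∫ ω', (∑ l, c' l * ∏ e, gegenbauerSum 1 (m' l e)
            (hsForm 2 (fundamentalRep (Fin 2) (g' l e)) (fundamentalRep (Fin 2) (Y z t ω' e)) / 2)) ∂P' :=
            mul_le_mul_of_nonneg_right (hφup z) h0
        _ ≤ _ := mul_le_mul_of_nonneg_left h1 (Real.exp_pos _).le
    calc Real.exp (-(K * t)) * ∫ ω, f (U z t ω) ∂P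
        ≤ Real.exp (-(K * t)) * ∫ ω, φ (U z t ω) * (∑ l, c' l * ∏ e, gegenbauerSum 1 (m' l e)
            (hsForm 2 (fundamentalRep (Fin 2) (g' l e)) (fundamentalRep (Fin 2) (U z t ω e)) / 2)) ∂P :=
          mul_le_mul_of_nonneg_left hleft (Real.exp_pos _).le
      _ ≤ φ z * ∫ ω', (∑ l, c' l * ∏ e, gegenbauerSum 1 (m' l e)
            (hsForm 2 (fundamentalRep (Fin 2) (g' l e)) (fundamentalRep (Fin 2) (Y z t ω' e)) / 2)) ∂P' := hsub
      _ ≤ _ := hright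
  -- let `ε → 0` and unwind
  have hlim : Real.exp (-(K * t)) * ∫ ω, f (U z t ω) ∂P ≤ Real.exp (Mψ / 2) * (Real.exp (Mψ / 2) * ∫ ω', f (Y z t ω') ∂P') := by
    refine le_of_forall_pos_le_add fun δ hδ => ?_
    have hpos : 0 < 2 * Real.exp (Mψ / 2) := by positivity
    have h := hmain (δ / (2 * Real.exp (Mψ / 2))) (div_pos hδ hpos)
    have heq : Real.exp (Mψ / 2) * (Real.exp (Mψ / 2) * ∫ ω', f (Y z t ω') ∂P' + 2 * (δ / (2 * Real.exp (Mψ / 2)))) =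
        Real.exp (Mψ / 2) * (Real.exp (Mψ / 2) * ∫ ω', f (Y z t ω') ∂P') + δ := by
      field_simp
    linarith [h, heq]
  have hexp : Real.exp (K * t + Mψ) = (Real.exp (-(K * t)))⁻¹ * (Real.exp (Mψ / 2) * Real.exp (Mψ / 2)) := by
    rw [← Real.exp_neg, ← Real.exp_add, ← Real.exp_add]; congr 1; ring
  rw [hexp, mul_assoc, mul_assoc]
  rw [← inv_mul_le_iff₀ (inv_pos.2 (Real.exp_pos _)), inv_inv]
  exact hlim

/-- **The law of the SZZ dynamics at every positive time is absolutely continuous w.r.t. Haar** (every coupling, every solution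
from a deterministic start on any probability space): `law(U_t) ≤ e^{Kt+M} law(Y_t) ≤ C · Haar^{⊗E}`. [folklore] -/
theorem map_absolutelyContinuous_haar (β' : ℝ) {t : ℝ≥0} (ht : 0 < (t : ℝ))
    (z : GaugeConfig 3 L (Matrix.specialUnitaryGroup (Fin 2) ℂ))
    {Ω : Type} [MeasurableSpace Ω] {P : Measure Ω} [IsProbabilityMeasure P]
    {W : ℝ≥0 → Ω → (Edge 3 L × NoiseIdx 2 → ℝ)} (hW : IsFlatBrownian W P)
    {U : ℝ≥0 → Ω → GaugeConfig 3 L (Matrix.specialUnitaryGroup (Fin 2) ℂ)} (hU0 : ∀ ω, U 0 ω = z)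
    (hU : (latticeLangevinDynamics (fundamentalLatticeRep 2) β').IsSolution (fundamentalRep (Fin 2)) hW.natFiltration P W U) :
    P.map (U t) ≪ (Measure.pi fun _ : Edge 3 L => haarProbability (Matrix.specialUnitaryGroup (Fin 2) ℂ)) := by
  classical
  haveI := secondCountableTopology_su2
  haveI := borelSpace_config L
  haveI : IsProbabilityMeasure (haarProbability (Matrix.specialUnitaryGroup (Fin 2) ℂ)) := inferInstance
  haveI := isProbabilityMeasure_piWiener (Edge 3 L × NoiseIdx 2)
  have hWc := isFlatBrownian_piWiener 3 L (NoiseIdx 2)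
  obtain ⟨X, GX, hX, hXm, -, -, -⟩ := exists_regularFlow L β' hWc
  obtain ⟨Y, GY, hY, hYm, -, -, -⟩ := exists_regularFlow L 0 hWc
  have hlaw : P.map (U t) = (Measure.pi fun _ : Edge 3 L × NoiseIdx 2 => preWienerMeasure).map (X z t) :=
    lawUnique_of_start β' z hW hWc hU0 hU (fun ω => (hX z).1 ω) (hX z).2 t
  rw [hlaw]
  have hmX : Measurable (X z t) := ((hX z).2.adapted t).mono (hWc.natFiltration.le t) le_rfl
  have hmY : Measurable (Y z t) := ((hY z).2.adapted t).mono (hWc.natFiltration.le t) le_rfl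
  set lawX := (Measure.pi fun _ : Edge 3 L × NoiseIdx 2 => preWienerMeasure).map (X z t) with hlawX
  set lawY := (Measure.pi fun _ : Edge 3 L × NoiseIdx 2 => preWienerMeasure).map (Y z t) with hlawY
  haveI : IsProbabilityMeasure lawX := Measure.isProbabilityMeasure_map hmX.aemeasurable
  haveI : IsProbabilityMeasure lawY := Measure.isProbabilityMeasure_map hmY.aemeasurable
  obtain ⟨K, Mψ, hcmp⟩ := integral_le_exp_mul_integral_beta_zero (L := L) β' hWc X hX hXm hWc Y hY hYm
  set c : ℝ := Real.exp (K * t + Mψ) with hc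
  haveI : IsFiniteMeasure ((ENNReal.ofReal c) • lawY) :=
    ⟨by rw [Measure.smul_apply, smul_eq_mul]; exact ENNReal.mul_lt_top ENNReal.ofReal_lt_top (measure_lt_top _ _)⟩
  have hle : lawX ≤ (ENNReal.ofReal c) • lawY := by
    refine measure_le_of_forall_integral_le fun f hf hf0 hf1 => ?_
    rw [integral_smul_measure, ENNReal.toReal_ofReal (Real.exp_pos _).le, smul_eq_mul, hlawX, hlawY,
      integral_map hmX.aemeasurable hf.aestronglyMeasurable, integral_map hmY.aemeasurable hf.aestronglyMeasurable]
    exact hcmp f hf hf0 hf1 z t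
  obtain ⟨C, -, hYle⟩ := map_le_smul_haar_beta_zero (L := L) ht z hWc (fun ω => (hY z).1 ω) (hY z).2
  have hle2 : lawX ≤ (ENNReal.ofReal c * ENNReal.ofReal C) •
      (Measure.pi fun _ : Edge 3 L => haarProbability (Matrix.specialUnitaryGroup (Fin 2) ℂ)) := by
    refine hle.trans (Measure.le_iff'.2 fun A => ?_)
    have h1 := Measure.le_iff'.1 hYle A
    simp only [Measure.smul_apply, smul_eq_mul] at h1 ⊢
    calc ENNReal.ofReal c * lawY A ≤ ENNReal.ofReal c * (ENNReal.ofReal C *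
        (Measure.pi fun _ : Edge 3 L => haarProbability (Matrix.specialUnitaryGroup (Fin 2) ℂ)) A) := mul_le_mul' le_rfl h1
      _ = _ := (mul_assoc _ _ _).symm
  exact Measure.absolutelyContinuous_of_le_smul hle2

/-- **The registered stub `stub_langevinLawAbsCont` of crux `NeutralColdStartMixing` (stmt-QuantumFields-27363)**, by name and
signature: for every cold-start solution of the SU(2) SZZ dynamics at coupling `(γ ε_K)⁻¹/2` and every lattice time `s > 0`, the
law of the gauge field read through the bond dictionary is absolutely continuous with respect to Bałaban's product Haar measure
`fieldMeasure`. [folklore] -/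
theorem stub_langevinLawAbsCont :
    ∀ (F : Literature.MathematicalPhysics.QuantumFieldTheory.Balaban1983to89.T3ContinuumYM3Torus.T3Family) (γ : ℝ), 0 < γ →
      ∀ (K : ℕ), ∀ (Ω : Type) (mΩ : MeasurableSpace Ω) (P : MeasureTheory.Measure Ω) (hP : MeasureTheory.IsProbabilityMeasure P)
        (W : NNReal → Ω → (Literature.MathematicalPhysics.QuantumFieldTheory.Edge 3 ((F.P K).sitesPerDir 0) ×
          Literature.MathematicalPhysics.QuantumFieldTheory.NoiseIdx 2 → ℝ))
        (hW : Literature.MathematicalPhysics.QuantumFieldTheory.IsFlatBrownian W P)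
        (U : NNReal → Ω → Literature.MathematicalPhysics.QuantumFieldTheory.GaugeConfig 3 ((F.P K).sitesPerDir 0)
          (Matrix.specialUnitaryGroup (Fin 2) ℂ)),
        (∀ ω, U 0 ω = fun _ => 1) →
        (Literature.MathematicalPhysics.QuantumFieldTheory.latticeLangevinDynamics
          (⟨2, Literature.MathematicalPhysics.QuantumLattice.fundamentalRep (Fin 2),
            Literature.MathematicalPhysics.QuantumLattice.continuous_fundamentalRep _,
            Literature.MathematicalPhysics.QuantumLattice.fundamentalRep_injective _,
            Literature.MathematicalPhysics.QuantumLattice.fundamentalRep_mem_unitaryGroup⟩ :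
            Literature.MathematicalPhysics.QuantumFieldTheory.LatticeRep (Matrix.specialUnitaryGroup (Fin 2) ℂ))
          ((γ * (F.P K).eps)⁻¹ / 2)).IsSolution (Literature.MathematicalPhysics.QuantumLattice.fundamentalRep (Fin 2))
          hW.natFiltration P W U →
        ∀ (s : NNReal), 0 < s →
          (P.map fun ω => (fun b : Literature.MathematicalPhysics.QuantumFieldTheory.Balaban1983to89.PBond (F.P K) 0 =>
            U s ω (b.src, b.dir))) ≪
            Literature.MathematicalPhysics.QuantumFieldTheory.Balaban1983to89.fieldMeasure (F.P K) 0
              (Matrix.specialUnitaryGroup (Fin 2) ℂ) := by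
  intro F γ hγ K Ω mΩ P hP W hW U hU0 hU s hs
  haveI := hP
  haveI := secondCountableTopology_su2
  haveI := borelSpace_config ((F.P K).sitesPerDir 0)
  have hU' : (latticeLangevinDynamics (fundamentalLatticeRep 2) ((γ * (F.P K).eps)⁻¹ / 2)).IsSolution (fundamentalRep (Fin 2))
      hW.natFiltration P W U := hU
  have hac := map_absolutelyContinuous_haar (L := (F.P K).sitesPerDir 0) ((γ * (F.P K).eps)⁻¹ / 2)
    (t := s) (by exact_mod_cast hs) (fun _ => 1) hW hU0 hU'
  have hmUs : Measurable (U s) := (hU'.adapted s).mono (hW.natFiltration.le s) le_rfl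
  have hdict : Measurable (fun V : GaugeConfig 3 ((F.P K).sitesPerDir 0) (Matrix.specialUnitaryGroup (Fin 2) ℂ) =>
      (fun b : Balaban1983to89.PBond (F.P K) 0 => V (b.src, b.dir) :
        Balaban1983to89.GaugeField (F.P K) 0 (Matrix.specialUnitaryGroup (Fin 2) ℂ))) :=
    measurable_pi_lambda _ fun b => measurable_pi_apply _
  have hcomp : (fun ω => (fun b : Balaban1983to89.PBond (F.P K) 0 => U s ω (b.src, b.dir))) =
      (fun V : GaugeConfig 3 ((F.P K).sitesPerDir 0) (Matrix.specialUnitaryGroup (Fin 2) ℂ) =>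
        (fun b : Balaban1983to89.PBond (F.P K) 0 => V (b.src, b.dir) :
          Balaban1983to89.GaugeField (F.P K) 0 (Matrix.specialUnitaryGroup (Fin 2) ℂ))) ∘ U s := rfl
  rw [hcomp, ← Measure.map_map hdict hmUs]
  have hpres := (measurePreserving_pullback (P := F.P K) (G := Matrix.specialUnitaryGroup (Fin 2) ℂ)).map_eq
  rw [← hpres]
  exact hac.map hdict

end Summit.QuantumFields.YangMills.Theorems.ColdStartUniversality

end
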